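import Summits.AnomalousDissipation.AnomalousDissipation.Theorems.BaireTransferRobustLoudUpgradeLinePeriodicDefs2
import Summits.AnomalousDissipation.AnomalousDissipation.Theorems.BaireTransferRobustLoudUpgradeStubLsBorderedPeriodic
import Summits.AnomalousDissipation.AnomalousDissipation.Theorems.BaireTransferRobustLoudUpgradeStubBorderedCone
import Summits.AnomalousDissipation.AnomalousDissipation.Theorems.BaireTransferRobustLoudUpgradeStubPeriodicRobustCrossingClosure

/-!
# Line `malkin-cone-group-orbits`, companion c3: the PERIODIC MALKIN CONE and the extended line glue

Definitions + glue (reviewed for the definition).  `malkinPeriodic` is the time-periodic twin of the generation-1 class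
`malkinSteady`: the force `f_c` is invariant along a lattice direction `dir`, it carries at some `ν ∈ (0,a)` a genuinely
time-dependent `τ`-periodic classical witness `u` with STRICT budgets whose free-period linearisation is SIMPLY degenerate
(kernel `∂ₜu, v` for one admissible real field `v` — for a witness with a non-trivial `dir`-orbit this is the Goldstone field
`∂_dir u`, normal nondegeneracy of the torus of cycles; no spectral gap, no hyperbolicity), and ONE symmetry-breaking direction
`d ∈ P_S` is first-order visible.  Then `c ∈ closure (interior LOUD)`: the landed bordered periodic persistence
`LsFamilyPeriodic.stub_lsBorderedPeriodic` (corrected forces `f_{c' − σ(c') d}` carry periodic orbits uniformly close to `u`,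
`σ c = 0`, `Dσ(c) d = 1`), the periodic budget window `PeriodicRobustCrossingClosure.exists_window`, and the landed ABSTRACT Malkin
cone on the `T³`-orbit `BorderedCone.mem_closure_interior_of_bordered` (characters along the lattice flow, zero mean of breaking
vectors, intermediate value theorem, cone engine).  `tamePeriodic3 := tamePeriodic2 ∪ malkinPeriodic`; `line_glue_c3c` (registered):
the residual over `tamePeriodic3` proves the crux BY NAME.  References: Vanderbauwhede 1982 Thm 8.2.11, §8.5; Dancer 1984;
Chow–Hale 1982 Ch. 9; Iooss 1972; Henry 1981 Ch. 8.
-/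

-- `Summit.<Summit>.<Problem>` is the tree's mandated summit-side namespace (CONVENTIONS §2); for this
-- single-conjunct summit the two coincide, so the duplicate is deliberate.
set_option linter.dupNamespace false

noncomputable section

open scoped BigOperators Topology
open Filter Set Function TopologicalSpace MeasureTheory

namespace Summit.AnomalousDissipation.AnomalousDissipation.Theorems.RobustLoudUpgrade

open Literature.Analysis.FunctionSpaces Literature.Analysis.FunctionSpaces.Torus
open Literature.Analysis.FluidPDE
open Summit.AnomalousDissipation.AnomalousDissipation.Theses.BaireTransfer

/-- **Malkin-visible simply degenerate periodic witnesses of a lattice-invariant force** (periodic twin of `malkinSteady`).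
`f_c` is invariant along the lattice direction `dir`; `c` carries, at some `ν ∈ (0,a)`, a genuinely time-dependent `τ`-periodic
classical witness `u` with STRICT budgets whose free-period linearisation is SIMPLY degenerate — every periodic solution of the
problem forced by a multiple of `∂ₜu` is a combination of `∂ₜu` and ONE real admissible `τ`-periodic field `v`, not a multiple of
`∂ₜu` (for a witness with a non-trivial `dir`-orbit, `v` is the Goldstone field `∂_dir u`: normal nondegeneracy of the torus of
cycles `T·{u(t)}`) — and ONE `dir`-BREAKING direction `d ∈ P_S` is first-order visible (no periodic solution of the problem forced by
`β ∂ₜu + f_d`).  No isolation, no spectral gap. (Vanderbauwhede 1982 §8.5; Dancer 1984; Iooss 1972.) [folklore] -/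
def malkinPeriodic (S : Finset (Fin 3 → ℤ)) (a E ε : ℝ) : Set (Coeff S) :=
  {c | ∃ ν : ℝ, 0 < ν ∧ ν < a ∧ ∃ (τ : ℝ) (u : ℝ → UnitAddTorus (Fin 3) → EuclideanSpace ℝ (Fin 3))
      (p : ℝ → UnitAddTorus (Fin 3) → ℝ), 0 < τ ∧
    IsClassicalNSSolutionOn Set.univ ν (fun _ => force S c) u p ∧ Function.Periodic u τ ∧
      meanEnergy u < E ∧ ε < meanDissipation ν u ∧ (∃ t x, Torus.timeDerivWithin Set.univ u t x ≠ 0) ∧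
      ∃ (dir : Fin 3 → ℤ) (v : ℝ → UnitAddTorus (Fin 3) → EuclideanSpace ℝ (Fin 3)) (d : Coeff S),
        c ∈ invariantAlong S dir ∧ d ∈ breakingAlong S dir ∧
        IsSmoothSpaceTimeOn Set.univ v ∧ Function.Periodic v τ ∧ (∀ t, IsDivFree (v t)) ∧ (∀ t, HasZeroMean (v t)) ∧
        (¬ ∃ z : ℂ, ∀ t x, Torus.realToComplex (v t x) = z • velocityDot u t x) ∧
        (∀ (w : ℝ → UnitAddTorus (Fin 3) → EuclideanSpace ℂ (Fin 3)) (β : ℂ),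
          w ∈ linPeriodicSol ν u τ (fun t x => β • velocityDot u t x) →
            ∃ z₁ z₂ : ℂ, ∀ t x, w t x = z₁ • velocityDot u t x + z₂ • Torus.realToComplex (v t x)) ∧
        (∀ β : ℂ, linPeriodicSol ν u τ (fun t x => β • velocityDot u t x + cplx (force S d) x) = ∅)}

/-- The tame union of the companion c3 after cycle 3: `tamePeriodic2` plus the periodic Malkin class. [folklore] -/
def tamePeriodic3 (S : Finset (Fin 3 → ℤ)) (a E ε : ℝ) : Set (Coeff S) :=
  tamePeriodic2 S a E ε ∪ malkinPeriodic S a E ε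

namespace LsCrossingPeriodic

/-- **The periodic Malkin cone (registered sub-goal `stub_malkinConePeriodic`)**: Malkin-visible simply degenerate periodic
witnesses of a lattice-invariant force are limits of force-open loudness — bordered periodic persistence
(`stub_lsBorderedPeriodic`), the periodic budget window, and the abstract cone on the `T³`-orbit. [folklore] -/
theorem stub_malkinConePeriodic : ∀ (S : Finset (Fin 3 → ℤ)) (a E ε : ℝ), malkinPeriodic S a E ε ⊆ closure (interior (loud S a E ε)) := by
  intro S a E ε c hc
  obtain ⟨ν, hν, hνa, τ, u, p, hτ, hsol, hper, hE, hε, hmov, dir, v, d, hcinv, hdbr, hsv, hperv, hvdiv, hv0, hdeg, hker, hvis⟩ := hc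
  obtain ⟨δ, hδ, hwin⟩ := PeriodicRobustCrossingClosure.exists_window hν hνa hτ hsol hper hE hε
  obtain ⟨σ, ℓ, hσ0, hσd, hℓd, hfam⟩ :=
    LsFamilyPeriodic.stub_lsBorderedPeriodic S c d ν τ u p v hν hτ hsol hper hmov hsv hperv hvdiv hv0 hdeg hker hvis
  obtain ⟨r, hr, hcont, hreal⟩ := hfam δ hδ
  refine BorderedCone.mem_closure_interior_of_bordered (A := loud S a E ε)
    (fun b e h => BorderedCone.mem_loud_of_phase_mem b e h) hcinv hdbr hσ0 hσd hℓd hr hcont fun c' hc' => ?_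
  obtain ⟨τ', u', p', hτ', hsol', hper', hclose⟩ := hreal c' hc'
  exact hwin (c' - σ c' • d) τ' u' p' hτ' hsol' hper' hclose

/-- **The tame union after cycle 3 is force-open up to closure.** [folklore] -/
theorem tamePeriodic3_subset_closure_interior_loud (S : Finset (Fin 3 → ℤ)) (a E ε : ℝ) :
    tamePeriodic3 S a E ε ⊆ closure (interior (loud S a E ε)) :=
  Set.union_subset (tamePeriodic2_subset_closure_interior_loud S a E ε) (stub_malkinConePeriodic S a E ε)

/-- **Extended line glue of the companion c3 (registered sub-goal `line_glue_c3c`)**: the residual over `tamePeriodic3` proves the crux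
`RobustLoudUpgrade` BY NAME. [folklore] -/
theorem line_glue_c3c : (∀ S : Finset (Fin 3 → ℤ), unitStock ⊆ S → ∀ (a E ε : ℝ), 0 < a → 0 < ε → loud S a E ε ⊆ closure (tamePeriodic3 S a (2 * E) (ε / 2))) → RobustLoudUpgrade :=
  fun hRes => LsCrossing.RobustLoudUpgrade_of_residual (fun S a E ε => tamePeriodic3 S a E ε)
    tamePeriodic3_subset_closure_interior_loud hRes

end LsCrossingPeriodic

end Summit.AnomalousDissipation.AnomalousDissipation.Theorems.RobustLoudUpgrade

end
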